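import Summits.AtomisticToContinuum.HydrodynamicLimit.Theses.UGibbsSRBRigidity
import Literature.MathematicalPhysics.StatisticalMechanics.HardSphereConditionalEquilibrium

/-!
# Birth skeleton of crux `URigiditySlaved` (U2, stmt-AtomisticToContinuum-13988) — route UGibbsSRBRigidity

Crux (by name): `Summit.AtomisticToContinuum.HydrodynamicLimit.Theses.UGibbsSRBRigidity.URigiditySlaved` —
there is `η₀ > 0` such that for every equilibrium, translation-covariant infinite hard-sphere flow `Φ`
(`d = 3`, diameter `1`) every probability law `μ` that is (a) translation invariant, (b′) `Φ`-a.e. defined,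
`Φ`-stationary with Sinai short-window collision clusters, (c) ergodic for the joint space–time action,
(d) of density in `(0, η₀)` and finite kinetic-energy density, (e) u-regular for the contact-slaved plaque
functor `slavedUnstablePlaques 1 Φ`, is a mixture of hard-sphere Gibbs states.

This file is the ELABORATING SKELETON the route dossier foresaw as the glued split
`U2 ⇐ LocalMicrocanonical → CanonicalToGibbs` (route file, TWO-LAYER PLAN), typed over the tree's
conditional-equilibrium vocabulary `Literature.MathematicalPhysics.StatisticalMechanics.IsHardSphereCEState`
/ `HardSphereCEStatesAreGibbsMixtures` (Aizenman–Goldstein–Lebowitz 1978 Def. 2.9 / Thm 5.1 shape,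
file `HardSphereConditionalEquilibrium.lean`, written for exactly these children), plus the one
ergodic-theoretic input that hands hypothesis (c) to the statics:

* `stub_localMicrocanonical` (DYNAMICS — infinite-volume Ledrappier–Young / Hopf; the hardest stub):
  below a density threshold `η₁`, every law satisfying (a), (b′), (c), finite kinetic-energy density and
  (e) is a CONDITIONAL-EQUILIBRIUM state w.r.t. `(N, P, E_kin)`: given the exterior of a bounded window,
  the interior law is absolutely continuous w.r.t. the Poisson–Maxwell reference with a density depending
  only on the local particle number, momentum and kinetic energy (unstable holonomy invariance from
  u-regularity, stable holonomy by reversibility / symplectic pairing, local `su`-accessibility inside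
  the finite short-window clusters of (b′): SinaiChernov1987, SimanyiSzasz1999, LedrappierYoung1985
  Thm A). Joint ergodicity (c) enters only to make the empirical density a.s. `< η₁` (no dense / jammed
  component, where local accessibility fails); `0 < density` is not needed (the vacuum is C.E.).
* `stub_diluteCEStatesAreGibbs` (STATICS — equivalence of ensembles, AGL 1978 Thm 5.1 with the momentum
  among the conserved quantities; Georgii1979): below a density threshold `η₂`, every translation-
  invariant, stationary, JOINTLY ERGODIC law of finite kinetic-energy density with a.s. infinitely many
  particles (AGL (5.3)) that is a C.E. state is a Gibbs mixture. Joint ergodicity pins the empirical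
  density to `density μ < η₂ < 3/(4π)`, which makes the state unsaturated (AGL Def. 5.1); the tree's
  mean-density form `HardSphereCEStatesAreGibbsMixtures 1 η₂` implies this stub but is itself exposed to
  mixtures carrying a small-weight saturated component, so it is NOT used as the stub.
* `stub_jointlyErgodicInfinite` (ERGODIC INPUT, where `0 < density` is consumed): a translation-
  invariant, `Φ`-a.e. defined, `Φ`-stationary probability law that is ergodic for the joint action of
  translations and the flow and has positive density has, almost surely, infinitely many particles
  (`{ω finite}` is translation-invariant and a.e. flow-invariant — particle number is conserved along good
  orbits —, so it is trivial; if it were full, `μ` would be a translation-invariant probability law on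
  finite configurations, hence `δ_∅` by the barycentre argument, contradicting `0 < density μ`). This is
  AGL's hypothesis (5.3) `N = ∞` a.s.; without it `½δ_∅ + ½g_z` shows C.E. ⇏ Gibbs mixture.

Composition `URigiditySlaved_of` (sorry-free): `η₀ := min η₁ η₂`; A gives the C.E. property, C the a.s.
infinitude, B the mixture. `sorry` occurs ONLY in the three `Holds.stub_*` theorems.
-/

noncomputable section

namespace Summit.AtomisticToContinuum.HydrodynamicLimit.Cruxes.URigiditySlaved.Birth

open MeasureTheory Set Filter
open scoped ENNReal

/-! ## Registered stubs (full signatures; `sorry` only here) -/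

namespace Holds

/-- **Stub A — LOCAL MICROCANONICAL PROPERTY of u-regular stationary states** (dynamics; the
infinite-volume Ledrappier–Young/Hopf step of U2): there is `η₁ > 0` such that for every equilibrium,
translation-covariant infinite hard-sphere flow `Φ` (`d = 3`, diameter `1`), every translation-invariant,
`Φ`-a.e. defined, `Φ`-stationary probability law with Sinai short-window clusters, ergodic for the joint
space–time action, of density `< η₁`, finite kinetic-energy density, u-regular for
`slavedUnstablePlaques 1 Φ`, is a conditional-equilibrium state of the hard-sphere gas w.r.t. number,
momentum and kinetic energy (`IsHardSphereCEState 1 μ`, AGL Def. 2.9). The crux's frame verbatim with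
u-regularity kept, `0 < density` dropped and the conclusion weakened from "Gibbs mixture" to "C.E.".
[cite: LedrappierYoung1985, Thm A] [cite: SinaiChernov1987] [cite: AizenmanGoldsteinLebowitz1978, Def. 2.9] -/
theorem stub_localMicrocanonical :
    ∃ η₁ : ℝ≥0∞, 0 < η₁ ∧
      ∀ Φ : Literature.Analysis.FluidPDE.InfiniteHardSphereFlow (Fin 3) 1,
        Φ.IsEquilibriumFlow → Φ.IsTranslationCovariant →
        ∀ μ : Measure (Literature.Analysis.FunctionSpaces.PointConfig
            (EuclideanSpace ℝ (Fin 3) × EuclideanSpace ℝ (Fin 3))),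
          IsProbabilityMeasure μ → Literature.Analysis.FluidPDE.IsTranslationInvariant μ →
          Φ.IsAEDefined μ → Φ.IsStationary μ →
          (∃ δ : ℝ, 0 < δ ∧ ∀ᵐ (ω : Literature.Analysis.FunctionSpaces.PointConfig
              (EuclideanSpace ℝ (Fin 3) × EuclideanSpace ℝ (Fin 3))) ∂μ,
            ∀ p ∈ (ω : Set (EuclideanSpace ℝ (Fin 3) × EuclideanSpace ℝ (Fin 3))), ∀ a : ℝ,
              (Literature.Analysis.FluidPDE.collisionCluster 1
                (ω : Set (EuclideanSpace ℝ (Fin 3) × EuclideanSpace ℝ (Fin 3))) (Φ.traj ω) a (a + δ)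
                  p).Finite) →
          (∀ A : Set (Literature.Analysis.FunctionSpaces.PointConfig
              (EuclideanSpace ℝ (Fin 3) × EuclideanSpace ℝ (Fin 3))), MeasurableSet A →
            (∀ a : EuclideanSpace ℝ (Fin 3), Literature.Analysis.FunctionSpaces.PointConfig.translate
                ((a, 0) : EuclideanSpace ℝ (Fin 3) × EuclideanSpace ℝ (Fin 3)) ⁻¹' A = A) →
            (∀ t : ℝ, Φ.flow t ⁻¹' A =ᵐ[μ] A) → μ A = 0 ∨ μ Aᶜ = 0) →
          Literature.MathematicalPhysics.KineticTheory.PointProcess.density μ < η₁ →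
          Literature.MathematicalPhysics.KineticTheory.kineticEnergyDensity μ < ⊤ →
          (Literature.Dynamics.Billiards.slavedUnstablePlaques 1 Φ).IsURegular μ →
          Literature.MathematicalPhysics.StatisticalMechanics.IsHardSphereCEState 1 μ := by
  sorry

/-- **Stub B — DILUTE JOINTLY ERGODIC C.E. STATES ARE GIBBS MIXTURES** (statics; equivalence of
ensembles for the hard-sphere gas with `X = (N, P, E_kin)`, the route's `CanonicalToGibbs`, in the
frame of the crux): there is `η₂ > 0` such that for every infinite hard-sphere flow `Φ` (`d = 3`,
diameter `1`) every translation-invariant, `Φ`-a.e. defined, `Φ`-stationary probability law that is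
ergodic for the joint space–time action, of density `< η₂`, finite kinetic-energy density, with a.s.
infinitely many particles (AGL (5.3)), and which is a conditional-equilibrium state
(`IsHardSphereCEState 1 μ`), is a mixture of hard-sphere Gibbs states. Joint ergodicity makes the
empirical density a.s. equal to `density μ < η₂ < 3/(4π)`, so the state is UNSATURATED in the sense of
AGL Def. 5.1 (room for a further sphere on a positive volume fraction) — the mean-density form
`HardSphereCEStatesAreGibbsMixtures 1 η₂` of the tree (no ergodicity) implies this stub but is exposed
to mixtures with a small-weight saturated component, which (c) excludes here.
[cite: AizenmanGoldsteinLebowitz1978, §5 Def. 5.1, Thm 5.1 (X = {H,N} version) p. 295] [cite: Georgii1979] -/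
theorem stub_diluteCEStatesAreGibbs :
    ∃ η₂ : ℝ≥0∞, 0 < η₂ ∧
      ∀ Φ : Literature.Analysis.FluidPDE.InfiniteHardSphereFlow (Fin 3) 1,
        ∀ μ : Measure (Literature.Analysis.FunctionSpaces.PointConfig
            (EuclideanSpace ℝ (Fin 3) × EuclideanSpace ℝ (Fin 3))),
          IsProbabilityMeasure μ → Literature.Analysis.FluidPDE.IsTranslationInvariant μ →
          Φ.IsAEDefined μ → Φ.IsStationary μ →
          (∀ A : Set (Literature.Analysis.FunctionSpaces.PointConfig
              (EuclideanSpace ℝ (Fin 3) × EuclideanSpace ℝ (Fin 3))), MeasurableSet A →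
            (∀ a : EuclideanSpace ℝ (Fin 3), Literature.Analysis.FunctionSpaces.PointConfig.translate
                ((a, 0) : EuclideanSpace ℝ (Fin 3) × EuclideanSpace ℝ (Fin 3)) ⁻¹' A = A) →
            (∀ t : ℝ, Φ.flow t ⁻¹' A =ᵐ[μ] A) → μ A = 0 ∨ μ Aᶜ = 0) →
          Literature.MathematicalPhysics.KineticTheory.PointProcess.density μ < η₂ →
          Literature.MathematicalPhysics.KineticTheory.kineticEnergyDensity μ < ⊤ →
          (∀ᵐ (ω : Literature.Analysis.FunctionSpaces.PointConfig
              (EuclideanSpace ℝ (Fin 3) × EuclideanSpace ℝ (Fin 3))) ∂μ,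
            ((ω : Literature.Analysis.FunctionSpaces.PointConfig
                (EuclideanSpace ℝ (Fin 3) × EuclideanSpace ℝ (Fin 3))) :
              Set (EuclideanSpace ℝ (Fin 3) × EuclideanSpace ℝ (Fin 3))).Infinite) →
          Literature.MathematicalPhysics.StatisticalMechanics.IsHardSphereCEState 1 μ →
          Literature.MathematicalPhysics.KineticTheory.IsHardSphereGibbsMixture 1 μ := by
  sorry

/-- **Stub C — JOINTLY ERGODIC STATES OF POSITIVE DENSITY ARE INFINITE A.S.** (the ergodic input,
AGL's (5.3)): a translation-invariant, `Φ`-a.e. defined, `Φ`-stationary probability law, ergodic for the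
joint action of the space translations and the flow, of positive density, gives full measure to
configurations with infinitely many particles. [cite: AizenmanGoldsteinLebowitz1978, §5 (5.3)] -/
theorem stub_jointlyErgodicInfinite :
    ∀ Φ : Literature.Analysis.FluidPDE.InfiniteHardSphereFlow (Fin 3) 1,
      ∀ μ : Measure (Literature.Analysis.FunctionSpaces.PointConfig
          (EuclideanSpace ℝ (Fin 3) × EuclideanSpace ℝ (Fin 3))),
        IsProbabilityMeasure μ → Literature.Analysis.FluidPDE.IsTranslationInvariant μ →
        Φ.IsAEDefined μ → Φ.IsStationary μ →
        (∀ A : Set (Literature.Analysis.FunctionSpaces.PointConfig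
            (EuclideanSpace ℝ (Fin 3) × EuclideanSpace ℝ (Fin 3))), MeasurableSet A →
          (∀ a : EuclideanSpace ℝ (Fin 3), Literature.Analysis.FunctionSpaces.PointConfig.translate
              ((a, 0) : EuclideanSpace ℝ (Fin 3) × EuclideanSpace ℝ (Fin 3)) ⁻¹' A = A) →
          (∀ t : ℝ, Φ.flow t ⁻¹' A =ᵐ[μ] A) → μ A = 0 ∨ μ Aᶜ = 0) →
        0 < Literature.MathematicalPhysics.KineticTheory.PointProcess.density μ →
        ∀ᵐ (ω : Literature.Analysis.FunctionSpaces.PointConfig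
            (EuclideanSpace ℝ (Fin 3) × EuclideanSpace ℝ (Fin 3))) ∂μ,
          ((ω : Literature.Analysis.FunctionSpaces.PointConfig
              (EuclideanSpace ℝ (Fin 3) × EuclideanSpace ℝ (Fin 3))) :
            Set (EuclideanSpace ℝ (Fin 3) × EuclideanSpace ℝ (Fin 3))).Infinite := by
  sorry

end Holds

/-! ## Stub statements by name (the hypotheses of `URigiditySlaved_of` are these `Prop`s) -/

/-- Statement of registered stub A (`Holds.stub_localMicrocanonical`), by name. -/
def stub_localMicrocanonical : Prop := type_of% Holds.stub_localMicrocanonical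
/-- Statement of registered stub B (`Holds.stub_diluteCEStatesAreGibbs`), by name. -/
def stub_diluteCEStatesAreGibbs : Prop := type_of% Holds.stub_diluteCEStatesAreGibbs
/-- Statement of registered stub C (`Holds.stub_jointlyErgodicInfinite`), by name. -/
def stub_jointlyErgodicInfinite : Prop := type_of% Holds.stub_jointlyErgodicInfinite

/-! ## Composition (sorry-free): the three stubs ⟹ the crux BY NAME -/

/-- **The skeleton theorem.** `η₀ := min η₁ η₂`: below it, stub A makes a law satisfying (a), (b′), (d),
(e) a conditional-equilibrium state, stub C turns (c) + `0 < density` into a.s. infinitely many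
particles, and stub B (equivalence of ensembles) delivers the Gibbs mixture. -/
theorem URigiditySlaved_of (hA : stub_localMicrocanonical) (hB : stub_diluteCEStatesAreGibbs)
    (hC : stub_jointlyErgodicInfinite) :
    Summit.AtomisticToContinuum.HydrodynamicLimit.Theses.UGibbsSRBRigidity.URigiditySlaved := by
  obtain ⟨η₁, hη₁, HA⟩ := (hA : type_of% Holds.stub_localMicrocanonical)
  obtain ⟨η₂, hη₂, HB⟩ := (hB : type_of% Holds.stub_diluteCEStatesAreGibbs)
  have HC := (hC : type_of% Holds.stub_jointlyErgodicInfinite)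
  refine ⟨min η₁ η₂, lt_min hη₁ hη₂, ?_⟩
  intro Φ hEq hCov μ hP hTI hAE hSt hCl hErg hρ0 hρ hKE hU
  -- stub A: the u-regular stationary law is a conditional-equilibrium state (threshold η₁)
  have hCE : Literature.MathematicalPhysics.StatisticalMechanics.IsHardSphereCEState 1 μ :=
    HA Φ hEq hCov μ hP hTI hAE hSt hCl hErg (lt_of_lt_of_le hρ (min_le_left _ _)) hKE hU
  -- stub C: joint ergodicity and positive density give infinitely many particles a.s.
  have hInf := HC Φ μ hP hTI hAE hSt hErg hρ0
  -- stub B: equivalence of ensembles for jointly ergodic dilute C.E. states (threshold η₂)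
  exact HB Φ μ hP hTI hAE hSt hErg (lt_of_lt_of_le hρ (min_le_right _ _)) hKE hInf hCE

/-- Wiring check: the registered stubs feed `URigiditySlaved_of` as stated. -/
example : Summit.AtomisticToContinuum.HydrodynamicLimit.Theses.UGibbsSRBRigidity.URigiditySlaved :=
  URigiditySlaved_of Holds.stub_localMicrocanonical Holds.stub_diluteCEStatesAreGibbs
    Holds.stub_jointlyErgodicInfinite

end Summit.AtomisticToContinuum.HydrodynamicLimit.Cruxes.URigiditySlaved.Birth

end
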